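import Summits.BirchSwinnertonDyer.BirchSwinnertonDyer.Theses.ClassRecordThree
import Summits.BirchSwinnertonDyer.BirchSwinnertonDyer.Theses.KolyvaginRoadThree
import Summits.BirchSwinnertonDyer.Rank1Residual.X11b.BDPRouteCyclotomicExceptional
import Summits.BirchSwinnertonDyer.Rank1Residual.X11b.RegMultCertificateJoin
import Literature.NumberTheory.EllipticCurves.Rank1Residual.MultiplicativeThreeTowerProofs
import Literature.NumberTheory.EllipticCurves.Rank1Residual.X9NoEntry
import HarnessLib

/-!
# Route `ClassRecordThree` (rung K2@3), crux 5 `EulerHalvesAtThree` (item 19109, shared with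
# `KolyvaginRoadThree`): the EXCEPTIONAL-ZERO ROAD AS AN EULER-HALF SUPPLIER — the whole crux from
# Kato's divisibility read through the `3`-adic leading terms, TAMAGAWA-BLIND, modulo the exceptional
# display on the split locus and a Schneider row (cell `bsd-stepL`, seat `bsd-stepL-mult-p4` g2;
# `--supports stmt-BirchSwinnertonDyer-19109`)

Cell `bsd-stepL` (D-0131 (3) middle tier, seat `bsd-stepL-mult-p4`, lens «split-multiplicative
`r = 1` via the 𝓛-invariant `p`-adic Gross–Zagier + Kobayashi 2006»). THEOREMS ONLY, CONDITIONAL on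
the PUBLISHED named facts in the binders and on the typed inputs named below; no definition, no new
fact, no `sorry`; nothing about any curve is asserted and no census word moves (TARGET T7).

## What

Crux 19109 `EulerHalvesAtThree` asks for the Euler-system (UPPER) half
`Typed.MissingUpperBoundAt W 3` (`Ш(E/ℚ)` finite and `ord₃ #Ш ≤ ord₃ #Ш_an`) of `BSD(E,3)` on three
loci of class X11b at `3` (`r_an = 1`, `3 ∥ N`, `E[3]` irreducible):
(1) `Ram W 3 → ShapeAlpha W → …` (a (ram) witness and `3` SPLIT with `3 ∣ c₃`);
(2) `Ram W 3 → split at 3 → ¬ShapeAlpha W → ShapeGamma W → …`;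
(3) `Surj W 3 → ¬Ram W 3 → …`.
Its registered line (`Cruxes/EulerHalvesAtThree/Lines/birth.lean` v7) reaches them through Kolyvagin's
bound at `3` (Jetchev's Tamagawa-divisibility `J₃` on multi-carrier frames ×2 and the X11a lower half
of the TWIST, `stub_x11aLowerHalfAtThree`) — the places where Kolyvagin's index loses units to
`3 ∣ ∏ c_ℓ`. Both (ram) clauses live on the SPLIT-at-`3` locus, the home of this seat's lens.

The cyclotomic reading of the upper half does not see Tamagawa numbers at all: Kato's divisibility
`char Sel_{p^∞}(E/ℚ_∞)^∨ ∣ ϖ·L_p(E,T)` (Wuthrich 2014 Thm. 3 ∕ Cor. 19 shape, EVERY `ρ̄_{E,3^n}` onto)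
compared through the two leading terms at `T = 0` — algebraic: Jones ∕ Stein–Wuthrich Thm. 6.1
(`𝓛_p·#Ш·Reg_p·∏c_v/#T²` split, `∏c_v·#Ш·Reg_p/#T²` non-split); analytic: the `p`-adic Gross–Zagier
display at the pair (SPLIT: the exceptional display `ClassClosure.RelativeExceptionalLeadingTermAt W 3`,
beyond print at `3`; NON-SPLIT: Disegni 2020 Thm. 1 = Thm. 4 first bullet, PUBLISHED at every odd `p`)
— gives `ord₃ #Ш[3^∞] ≤ ord₃ #Ш_an` as soon as the Schneider height of THE §4.2 datum is
non-degenerate, because BOTH leading terms carry the same `∏ c_v` (tree engines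
`X11b.missingUpperBoundAt_of_katoSurj_split_of_relativeLeadingTerm`,
`X11b.missingUpperBoundAt_of_katoSurj_nonsplit_of_schneider`, team x11b3). At `p = 3` Kato's image
hypothesis is a THEOREM on the whole of X11b@3 ∩ `Surj`: `Mult W 3 ∧ Surj W 3 ⟹ ρ̄_{E,3^n}` onto for
all `n` (`Rank1Residual.surjective_pow_of_mult_of_surj`, the Tate line; no Lemma-20 binder, no mod-`9`
certificate), and `Surj W 3` itself is automatic on the (ram) locus (`surj_of_irr_of_ram`: an
irreducible subgroup of `GL₂(𝔽₃)` containing a transvection contains `SL₂(𝔽₃)`).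

## Results (namespace `…Theorems.ExceptionalZeroRoad`)

§1 (pairs). `Three.towerSurj_of_classX11b_of_surj` ∕ `_of_ram`;
`Three.missingUpperBoundAt_of_surj_split_of_conjecture_of_schneiderSplit` — a SPLIT X11b@3 pair with
`Surj W 3`: conj@3 + the split Schneider half ⟹ the upper half (no (ram), no Tamagawa shape, no
Skinner–Urban); `Three.missingUpperBoundAt_of_surj_nonsplit_of_schneiderNonsplit` — a NON-SPLIT
X11b@3 pair with `Surj W 3`: the non-split Schneider half ⟹ the upper half, every class-level input
PUBLISHED; `…_of_regulatorNonvanishing_of_conjecture` (both, bundled `RegulatorNonvanishingAt`);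
certificate currency `…_of_certSplit_of_conjecture` ∕ `…_of_certNonsplit` (ONE REGMULT row
`RegMult.CertSplit ∕ CertNonsplit W 3 P m`; 960∕961 split and 723∕723 non-split B10 rows CERT of record).
§2 (the crux). `Three.eulerHalves_ramClauses_of_conjecture_of_schneiderSplit` — clauses (1) ∧ (2)
verbatim from conj@3 + the split Schneider half on split (ram) pairs;
`Three.eulerHalves_notRamClause_of_conjecture_of_schneider` — clause (3);
**`classRecordThree_eulerHalvesAtThree_of_conjecture_of_schneider`** — the route decl
`Theses.ClassRecordThree.EulerHalvesAtThree` BY NAME from eight PUBLISHED named facts (Kato–Wuthrich,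
SW Thm. 6.1 split ∕ non-split + §4.2 heights ×2, Disegni Thm. 1, GZK, modular parametrisation) + conj@3
on the split locus + the two Schneider halves on their loci; the `KolyvaginRoadThree` twin; and the
`PublishedInputsThree` packaging `…_of_publishedInputs_…` (items 19112's conjuncts 6, 15, 16, 17, 18 +
THREE further PUB facts the class record does not carry: Kato's divisibility in Wuthrich's surjective
shape, SW Thm. 6.1 SPLIT, the split canonical height).

## Reading (numbers of record, TARGET §2; nothing moves)

* On the 961 TRUE-OPEN split ∧ (ram) B10 classes, clauses (1)–(2) of crux 19109 ⟸ conj@3 + ONE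
  split REGMULT row per pair (960∕961 CERT) — an alternative to the line's J₃-multi ∕ twist stubs
  there, modulo ONE analytic identity whose `p ≥ 5` version (second multiplicative prime = the (ram)
  prime) is Disegni 2020 Thm. 1; beyond print at `3` (gen 0 memo §2: Hida ∕ Greenberg–Stevens ∕ BD07 ∕
  Büyükboduk standing `p ≥ 5`). No Skinner 2016 theorem is used, so no FLAG `SU14-12.3.6-mu@nonsplit@3`.
* On ¬(ram) ∧ surj pairs NON-SPLIT at `3`, clause (3) ⟸ ONE non-split REGMULT row, every class-level
  input PUBLISHED (Disegni's first bullet has no restriction on `p`); split ones need conj@3 as above.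
* With gen 0 (`relativeExceptionalLeadingTermAt_of_bsdp`: conj@3 ⟸ BSD₃ on (ram) ∧ split) the input is
  not stronger than the target; with gen 1 (`mazurMainConjectureAt_of_missingLowerBoundAt_of_split`)
  the same three inputs + the LOWER half give Mazur's main conjecture at `(E,3)`.
CONDITIONAL; closes nothing; the crux's registered stubs are untouched (this is a second supplier, by
name, for the planner to register or not).

References: [Wuthrich2014] Thm. 3 (p. 383), Cor. 19, Lemma 20 (p. 399); [SteinWuthrich2013] Thm. 6.1,
§4.2; [Disegni2020] Thm. 1 (§1.2) = Thm. 4 (§3.2); [MazurTateTeitelbaum1986Invent] §II.10;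
[Kato2004Asterisque] Thm. 17.4, (12.5.2); [SerreInventiones1972] §2 Prop. 15; [Miller2011LMS] Def. 1.1;
[Jetchev2008] Thm. 1.4 (the road NOT taken here). Cell files: HOME/mult-p4/EXZ-ROAD-MEMO-g0/g1/g2.md.
-/

set_option autoImplicit false

-- Theorems files of this problem live in `Summit.BirchSwinnertonDyer.BirchSwinnertonDyer.Theorems.*`.
set_option linter.dupNamespace false

noncomputable section

open scoped Classical MatrixGroups ModularForm

open CongruenceSubgroup WeierstrassCurve Literature.NumberTheory.EllipticCurves
  Literature.NumberTheory.EllipticCurves.ModularForms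
  Literature.NumberTheory.EllipticCurves.Rank1Residual
  Literature.NumberTheory.EllipticCurves.Rank1Residual.Typed
  Literature.NumberTheory.EllipticCurves.SteinWuthrich2013
  Literature.NumberTheory.EllipticCurves.Wuthrich2014

namespace Summit.BirchSwinnertonDyer.BirchSwinnertonDyer.Theorems.ExceptionalZeroRoad

open Summit.BirchSwinnertonDyer.Rank1Residual Summit.BirchSwinnertonDyer.Rank1Residual.X11b
  Summit.BirchSwinnertonDyer.Rank1Residual.X11b.Three

/-! ### §1 One pair at a time -/

section Pair

variable (W : WeierstrassCurve ℚ) [W.IsElliptic] [W.IsGloballyMinimal]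

omit [W.IsGloballyMinimal] in
/-- **The `3`-adic tower on X11b@3 ∩ `Surj`, unconditionally**: multiplicative reduction at `3` and
`ρ̄_{E,3}` onto give `ρ̄_{E,3^n}` onto for every `n` (tree theorem
`Rank1Residual.surjective_pow_of_mult_of_surj`: the Tate line + `det = χ₃`; Wuthrich's Lemma 20 on this
locus, binder-free) — Kato's image hypothesis in Wuthrich's shape. [cite: Wuthrich2014, Lemma 20 (p. 399), Cor. 19]
[cite: SerreAbelianLadic1968, IV A.1.2–A.1.3] -/
theorem Three.towerSurj_of_classX11b_of_surj (hX : ClassX11b W 3) (hsurj : Surj W 3) :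
    ∀ n : ℕ, W.HasSurjectiveModNGaloisRep (3 ^ n : ℕ) :=
  surjective_pow_of_mult_of_surj W (by decide) hX.2.2.1 hsurj

/-- **On the (ram) locus of X11b@3 the tower is onto with NO image hypothesis**: `E[3]` irreducible
and ramified at a multiplicative prime `ℓ ≠ 3` (a transvection in the image) force `ρ̄_{E,3}` onto
(`surj_of_irr_of_ram`, Serre 1972 §2 Prop. 15), then `Three.towerSurj_of_classX11b_of_surj`.
[cite: SerreInventiones1972, §2 Prop. 15] [cite: Wuthrich2014, Lemma 20 (p. 399)] -/
theorem Three.towerSurj_of_classX11b_of_ram (hX : ClassX11b W 3) (hram : Ram W 3) :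
    ∀ n : ℕ, W.HasSurjectiveModNGaloisRep (3 ^ n : ℕ) :=
  Three.towerSurj_of_classX11b_of_surj W hX (surj_of_irr_of_ram W 3 hX.2.2.2 hram)

/-- **SPLIT X11b@3 pair with `ρ̄_{E,3}` onto: the Euler half from the exceptional-zero road.**
Kato's divisibility (`hKato`, Wuthrich 2014 Thm. 3 ∕ Cor. 19 shape; its image hypothesis discharged by
`Three.towerSurj_of_classX11b_of_surj`) + Jones's split leading term (`hJs`, SW Thm. 6.1) + the split
canonical height (`hHs`, SW §4.2) + GZK + a modular parametrisation, read through the EXCEPTIONAL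
DISPLAY at the pair (`hC : ClassClosure.RelativeExceptionalLeadingTermAt W 3`, beyond print at `3`) and
the split Schneider half (`hSch`, per-pair certifiable) ⟹ `Typed.MissingUpperBoundAt W 3`. No (ram),
no Tamagawa shape, no Skinner–Urban. CONDITIONAL on the unproved display; nothing booked.
[cite: Wuthrich2014, Thm. 3 (p. 383), Cor. 19] [cite: SteinWuthrich2013, Thm. 6.1, §4.2 (p. 16)]
[cite: MazurTateTeitelbaum1986Invent, §II.10] [cite: Miller2011LMS, Def. 1.1] -/
theorem Three.missingUpperBoundAt_of_surj_split_of_conjecture_of_schneiderSplit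
    (hKato : kato_charIdeal_dvd_multiplicative_of_surjective) (hJs : thm61_splitMultiplicative)
    (hHs : exists_isSplitMultCanonical) (hGZK : rank_eq_analyticRank_of_analyticRank_le_one)
    (hpar : nonempty_modularParametrizationData)
    (hX : ClassX11b W 3) (hsurj : Surj W 3) (hsplit : W.HasSplitMultiplicativeReductionAtPrime 3)
    (hC : ClassClosure.RelativeExceptionalLeadingTermAt W 3)
    (hSch : ∀ (Dq : TateParameterData W 3) (Dh : PAdicHeightData W 3),
      IsSplitMultCanonical Dh Dq → SchneiderConjecture Dh) :
    Typed.MissingUpperBoundAt W 3 :=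
  missingUpperBoundAt_of_katoSurj_split_of_relativeLeadingTerm W 3 hKato hJs hHs hGZK hpar hX.2.1
    hX.2.2.1 hsplit hX.1 (Three.towerSurj_of_classX11b_of_surj W hX hsurj) hC hSch

/-- **NON-SPLIT X11b@3 pair with `ρ̄_{E,3}` onto: the Euler half from the published record modulo the
Schneider row.** Kato (`hKato`) + SW Thm. 6.1 non-split (`hJn`) + the canonical height (`hHn`) +
Disegni 2020 Thm. 1 NON-split clause at the pair (`hDf`; Thm. 4 first bullet has no restriction on `p`)
+ GZK + parametrisation, and the non-split Schneider half (`hSch`) ⟹ `Typed.MissingUpperBoundAt W 3`.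
Every class-level input PUBLISHED; per pair `hSch` is one REGMULT row. CONDITIONAL; nothing booked.
[cite: Disegni2020, Thm. 1 (§1.2) = Thm. 4 first bullet (§3.2)] [cite: Wuthrich2014, Thm. 3, Cor. 19]
[cite: SteinWuthrich2013, Thm. 6.1, §4.2 (p. 15)] [cite: Miller2011LMS, Def. 1.1] -/
theorem Three.missingUpperBoundAt_of_surj_nonsplit_of_schneiderNonsplit
    (hKato : kato_charIdeal_dvd_multiplicative_of_surjective) (hJn : thm61_nonsplitMultiplicative)
    (hHn : exists_isMultCanonical) (hDf : Disegni2020.thm1_padicBSD_rankOne_multiplicative)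
    (hGZK : rank_eq_analyticRank_of_analyticRank_le_one) (hpar : nonempty_modularParametrizationData)
    (hX : ClassX11b W 3) (hsurj : Surj W 3) (hns : ¬ W.HasSplitMultiplicativeReductionAtPrime 3)
    (hSch : ∀ (q : ℚ_[3]) (Dh : PAdicHeightData W 3), q ≠ 0 → ‖q‖ < 1 → tateJ q = (W.j : ℚ_[3]) →
      IsMultCanonical Dh q → SchneiderConjecture Dh) :
    Typed.MissingUpperBoundAt W 3 :=
  missingUpperBoundAt_of_katoSurj_nonsplit_of_schneider W 3 hKato hJn hHn hDf hGZK hpar hX.2.1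
    hX.2.2.1 hns hX.1 (Three.towerSurj_of_classX11b_of_surj W hX hsurj) hSch

/-- **Any X11b@3 pair with `ρ̄_{E,3}` onto**: the bundled regulator predicate
`ClassClosure.RegulatorNonvanishingAt W 3` (rung I1 at `3`, both Schneider halves) and, IF the pair is
split at `3`, the exceptional display ⟹ the Euler half. CONDITIONAL; nothing booked.
[cite: Wuthrich2014, Thm. 3, Cor. 19] [cite: SteinWuthrich2013, Thm. 6.1, §4.2]
[cite: Disegni2020, Thm. 1 (§1.2)] [cite: Miller2011LMS, Def. 1.1] -/
theorem Three.missingUpperBoundAt_of_surj_of_regulatorNonvanishing_of_conjecture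
    (hKato : kato_charIdeal_dvd_multiplicative_of_surjective) (hJs : thm61_splitMultiplicative)
    (hJn : thm61_nonsplitMultiplicative) (hHs : exists_isSplitMultCanonical)
    (hHn : exists_isMultCanonical) (hDf : Disegni2020.thm1_padicBSD_rankOne_multiplicative)
    (hGZK : rank_eq_analyticRank_of_analyticRank_le_one) (hpar : nonempty_modularParametrizationData)
    (hX : ClassX11b W 3) (hsurj : Surj W 3) (hReg : ClassClosure.RegulatorNonvanishingAt W 3)
    (hC : W.HasSplitMultiplicativeReductionAtPrime 3 → ClassClosure.RelativeExceptionalLeadingTermAt W 3) :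
    Typed.MissingUpperBoundAt W 3 := by
  by_cases hsplit : W.HasSplitMultiplicativeReductionAtPrime 3
  · exact Three.missingUpperBoundAt_of_surj_split_of_conjecture_of_schneiderSplit W hKato hJs hHs hGZK
      hpar hX hsurj hsplit (hC hsplit) hReg.2
  · exact Three.missingUpperBoundAt_of_surj_nonsplit_of_schneiderNonsplit W hKato hJn hHn hDf hGZK
      hpar hX hsurj hsplit hReg.1

/-- **Certificate currency, SPLIT** (the 961 TRUE-OPEN split (ram) B10 classes; 960∕961 rows CERT in
`regmult_prod_X11b3_split.tsv`, EVIDENCE): ONE split row `RegMult.CertSplit W 3 P m` + `Surj W 3`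
(automatic on (ram): `surj_of_irr_of_ram`) + the exceptional display ⟹ the Euler half. CONDITIONAL on
the display; rows are instrumentation; nothing booked. [cite: SteinWuthrich2013, §4.2 (p. 16)]
[cite: Wuthrich2014, Thm. 3, Cor. 19] [cite: MazurTateTeitelbaum1986Invent, §II.10] -/
theorem Three.missingUpperBoundAt_of_surj_split_of_certSplit_of_conjecture
    (hKato : kato_charIdeal_dvd_multiplicative_of_surjective) (hJs : thm61_splitMultiplicative)
    (hHs : exists_isSplitMultCanonical) (hGZK : rank_eq_analyticRank_of_analyticRank_le_one)
    (hpar : nonempty_modularParametrizationData)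
    (hX : ClassX11b W 3) (hsurj : Surj W 3) (hsplit : W.HasSplitMultiplicativeReductionAtPrime 3)
    {P : W.toAffine.Point} {m : ℕ} (hc : RegMult.CertSplit W 3 P m)
    (hC : ClassClosure.RelativeExceptionalLeadingTermAt W 3) :
    Typed.MissingUpperBoundAt W 3 :=
  Three.missingUpperBoundAt_of_surj_split_of_conjecture_of_schneiderSplit W hKato hJs hHs hGZK hpar hX
    hsurj hsplit hC (RegMult.schneiderHalf_split_of_cert (mordellWeilRank_eq_one_of_analyticRank hGZK hX.1) hc)

/-- **Certificate currency, NON-SPLIT** (723∕723 non-split B10 rows CERT in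
`regmult_prod_X11b3_nonsplit.tsv`, EVIDENCE): ONE row `RegMult.CertNonsplit W 3 P m` + `Surj W 3` ⟹
the Euler half, every class-level input PUBLISHED. Rows are instrumentation; nothing booked.
[cite: SteinWuthrich2013, §4.2 (p. 15)] [cite: Disegni2020, Thm. 1 (§1.2)] [cite: Wuthrich2014, Thm. 3, Cor. 19] -/
theorem Three.missingUpperBoundAt_of_surj_nonsplit_of_certNonsplit
    (hKato : kato_charIdeal_dvd_multiplicative_of_surjective) (hJn : thm61_nonsplitMultiplicative)
    (hHn : exists_isMultCanonical) (hDf : Disegni2020.thm1_padicBSD_rankOne_multiplicative)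
    (hGZK : rank_eq_analyticRank_of_analyticRank_le_one) (hpar : nonempty_modularParametrizationData)
    (hX : ClassX11b W 3) (hsurj : Surj W 3) (hns : ¬ W.HasSplitMultiplicativeReductionAtPrime 3)
    {P : W.toAffine.Point} {m : ℕ} (hc : RegMult.CertNonsplit W 3 P m) :
    Typed.MissingUpperBoundAt W 3 :=
  Three.missingUpperBoundAt_of_surj_nonsplit_of_schneiderNonsplit W hKato hJn hHn hDf hGZK hpar hX
    hsurj hns (RegMult.schneiderHalf_nonsplit_of_cert (mordellWeilRank_eq_one_of_analyticRank hGZK hX.1) hc)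

end Pair

/-! ### §2 The crux `EulerHalvesAtThree` by name -/

section Crux

/-- **Clauses (1) ∧ (2) of crux 19109 — the two (ram) clauses, both on the SPLIT-at-`3` locus
(`ShapeAlpha W` contains «split at `3`») — from the exceptional display and the split Schneider half
on split (ram) X11b@3 pairs**, Tamagawa-blind (the shapes `ShapeAlpha` ∕ `ShapeGamma` are not used):
Kato + SW 6.1 split + split height + GZK + parametrisation (PUBLISHED), `Surj W 3` from (ram).
CONDITIONAL on `hC` (beyond print at `3`) and `hSch` (rung I1 on the split (ram) locus; per pair one
REGMULT row); nothing booked. [cite: Wuthrich2014, Thm. 3, Cor. 19] [cite: SteinWuthrich2013, Thm. 6.1, §4.2]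
[cite: MazurTateTeitelbaum1986Invent, §II.10] [cite: Miller2011LMS, Def. 1.1] -/
theorem Three.eulerHalves_ramClauses_of_conjecture_of_schneiderSplit
    (hKato : kato_charIdeal_dvd_multiplicative_of_surjective) (hJs : thm61_splitMultiplicative)
    (hHs : exists_isSplitMultCanonical) (hGZK : rank_eq_analyticRank_of_analyticRank_le_one)
    (hpar : nonempty_modularParametrizationData)
    (hC : ∀ (W : WeierstrassCurve ℚ) [W.IsElliptic] [W.IsGloballyMinimal], ClassX11b W 3 → Ram W 3 →
      W.HasSplitMultiplicativeReductionAtPrime 3 → ClassClosure.RelativeExceptionalLeadingTermAt W 3)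
    (hSch : ∀ (W : WeierstrassCurve ℚ) [W.IsElliptic] [W.IsGloballyMinimal], ClassX11b W 3 → Ram W 3 →
      W.HasSplitMultiplicativeReductionAtPrime 3 → ∀ (Dq : TateParameterData W 3) (Dh : PAdicHeightData W 3),
        IsSplitMultCanonical Dh Dq → SchneiderConjecture Dh) :
    ∀ (W : WeierstrassCurve ℚ) [W.IsElliptic] [W.IsGloballyMinimal], ClassX11b W 3 →
      (Ram W 3 → ShapeAlpha W → Typed.MissingUpperBoundAt W 3) ∧
      (Ram W 3 → W.HasSplitMultiplicativeReductionAtPrime 3 → ¬ ShapeAlpha W → ShapeGamma W →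
        Typed.MissingUpperBoundAt W 3) := by
  intro W _ _ hX
  have key : Ram W 3 → W.HasSplitMultiplicativeReductionAtPrime 3 → Typed.MissingUpperBoundAt W 3 :=
    fun hram hsplit ↦
      Three.missingUpperBoundAt_of_surj_split_of_conjecture_of_schneiderSplit W hKato hJs hHs hGZK hpar hX
        (surj_of_irr_of_ram W 3 hX.2.2.2 hram) hsplit (hC W hX hram hsplit) (hSch W hX hram hsplit)
  exact ⟨fun hram hα ↦ key hram hα.1, fun hram hsplit _ _ ↦ key hram hsplit⟩

/-- **Clause (3) of crux 19109 — the ¬(ram) ∧ surj locus — from the bundled regulator predicate and,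
on its split part, the exceptional display**: non-split pairs use Disegni's PUBLISHED non-split clause
and the non-split Schneider half only; split pairs use `hC`. CONDITIONAL; nothing booked.
[cite: Disegni2020, Thm. 1 (§1.2) = Thm. 4 first bullet (§3.2)] [cite: Wuthrich2014, Thm. 3, Cor. 19]
[cite: SteinWuthrich2013, Thm. 6.1, §4.2] [cite: Miller2011LMS, Def. 1.1] -/
theorem Three.eulerHalves_notRamClause_of_conjecture_of_regulatorNonvanishing
    (hKato : kato_charIdeal_dvd_multiplicative_of_surjective) (hJs : thm61_splitMultiplicative)
    (hJn : thm61_nonsplitMultiplicative) (hHs : exists_isSplitMultCanonical)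
    (hHn : exists_isMultCanonical) (hDf : Disegni2020.thm1_padicBSD_rankOne_multiplicative)
    (hGZK : rank_eq_analyticRank_of_analyticRank_le_one) (hpar : nonempty_modularParametrizationData)
    (hC : ∀ (W : WeierstrassCurve ℚ) [W.IsElliptic] [W.IsGloballyMinimal], ClassX11b W 3 → ¬ Ram W 3 →
      Surj W 3 → W.HasSplitMultiplicativeReductionAtPrime 3 →
        ClassClosure.RelativeExceptionalLeadingTermAt W 3)
    (hReg : ∀ (W : WeierstrassCurve ℚ) [W.IsElliptic] [W.IsGloballyMinimal], ClassX11b W 3 → ¬ Ram W 3 →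
      Surj W 3 → ClassClosure.RegulatorNonvanishingAt W 3) :
    ∀ (W : WeierstrassCurve ℚ) [W.IsElliptic] [W.IsGloballyMinimal], ClassX11b W 3 →
      Surj W 3 → ¬ Ram W 3 → Typed.MissingUpperBoundAt W 3 :=
  fun W _ _ hX hsurj hnr ↦
    Three.missingUpperBoundAt_of_surj_of_regulatorNonvanishing_of_conjecture W hKato hJs hJn hHs hHn hDf
      hGZK hpar hX hsurj (hReg W hX hnr hsurj) (hC W hX hnr hsurj)

/-- **Crux 19109 `EulerHalvesAtThree` of route `ClassRecordThree`, BY NAME, from the exceptional-zero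
road.** Inputs: eight PUBLISHED named facts (Kato's divisibility in Wuthrich's surjective shape `hKato`;
Stein–Wuthrich Thm. 6.1 split `hJs` ∕ non-split `hJn` and the §4.2 heights `hHs` ∕ `hHn`; Disegni 2020
Thm. 1 `hDf`, used only through its NON-split clause; GZK `hGZK`; modular parametrisations `hpar`), the
exceptional display on the SPLIT locus of X11b@3 ∩ `Surj` (`hC`, the cell's `@[conjecture]`
`ClassClosure.RelativeExceptionalLeadingTermAt W 3` — beyond print at `3`), and the two Schneider halves
on their loci (`hSchS` on split pairs, `hSchN` on ¬(ram) non-split pairs, both under `Surj W 3` — rung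
I1 at `3`; per pair ONE REGMULT row each). `Surj W 3` is automatic on the (ram) clauses
(`surj_of_irr_of_ram`) and Kato's tower hypothesis is DISCHARGED (`surjective_pow_of_mult_of_surj`);
Tamagawa shapes are not used; no Skinner–Urban theorem enters (no FLAG `SU14-12.3.6-mu@nonsplit@3`).
CONDITIONAL on `hC`, `hSchS`, `hSchN`; closes nothing; the crux's registered Kolyvagin-road stubs are
untouched. [cite: Wuthrich2014, Thm. 3 (p. 383), Cor. 19] [cite: SteinWuthrich2013, Thm. 6.1, §4.2]
[cite: Disegni2020, Thm. 1 (§1.2) = Thm. 4 (§3.2)] [cite: MazurTateTeitelbaum1986Invent, §II.10]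
[cite: Miller2011LMS, Def. 1.1] -/
theorem classRecordThree_eulerHalvesAtThree_of_conjecture_of_schneider
    (hKato : kato_charIdeal_dvd_multiplicative_of_surjective) (hJs : thm61_splitMultiplicative)
    (hJn : thm61_nonsplitMultiplicative) (hHs : exists_isSplitMultCanonical)
    (hHn : exists_isMultCanonical) (hDf : Disegni2020.thm1_padicBSD_rankOne_multiplicative)
    (hGZK : rank_eq_analyticRank_of_analyticRank_le_one) (hpar : nonempty_modularParametrizationData)
    (hC : ∀ (W : WeierstrassCurve ℚ) [W.IsElliptic] [W.IsGloballyMinimal], ClassX11b W 3 → Surj W 3 →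
      W.HasSplitMultiplicativeReductionAtPrime 3 → ClassClosure.RelativeExceptionalLeadingTermAt W 3)
    (hSchS : ∀ (W : WeierstrassCurve ℚ) [W.IsElliptic] [W.IsGloballyMinimal], ClassX11b W 3 → Surj W 3 →
      W.HasSplitMultiplicativeReductionAtPrime 3 → ∀ (Dq : TateParameterData W 3) (Dh : PAdicHeightData W 3),
        IsSplitMultCanonical Dh Dq → SchneiderConjecture Dh)
    (hSchN : ∀ (W : WeierstrassCurve ℚ) [W.IsElliptic] [W.IsGloballyMinimal], ClassX11b W 3 → ¬ Ram W 3 →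
      Surj W 3 → ¬ W.HasSplitMultiplicativeReductionAtPrime 3 →
        ∀ (q : ℚ_[3]) (Dh : PAdicHeightData W 3), q ≠ 0 → ‖q‖ < 1 → tateJ q = (W.j : ℚ_[3]) →
          IsMultCanonical Dh q → SchneiderConjecture Dh) :
    Summit.BirchSwinnertonDyer.BirchSwinnertonDyer.Theses.ClassRecordThree.EulerHalvesAtThree := by
  intro W _ _ hX
  have hsp : Surj W 3 → W.HasSplitMultiplicativeReductionAtPrime 3 → Typed.MissingUpperBoundAt W 3 :=
    fun hsurj hsplit ↦
      Three.missingUpperBoundAt_of_surj_split_of_conjecture_of_schneiderSplit W hKato hJs hHs hGZK hpar hX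
        hsurj hsplit (hC W hX hsurj hsplit) (hSchS W hX hsurj hsplit)
  refine ⟨fun hram hα ↦ hsp (surj_of_irr_of_ram W 3 hX.2.2.2 hram) hα.1,
    fun hram hsplit _ _ ↦ hsp (surj_of_irr_of_ram W 3 hX.2.2.2 hram) hsplit, fun hsurj hnr ↦ ?_⟩
  by_cases hsplit : W.HasSplitMultiplicativeReductionAtPrime 3
  · exact hsp hsurj hsplit
  · exact Three.missingUpperBoundAt_of_surj_nonsplit_of_schneiderNonsplit W hKato hJn hHn hDf hGZK hpar
      hX hsurj hsplit (hSchN W hX hnr hsurj hsplit)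

/-- **The `KolyvaginRoadThree` twin** (same statement, same proof term). [cite: Wuthrich2014, Thm. 3, Cor. 19]
[cite: SteinWuthrich2013, Thm. 6.1, §4.2] [cite: Disegni2020, Thm. 1 (§1.2)] -/
theorem kolyvaginRoadThree_eulerHalvesAtThree_of_conjecture_of_schneider
    (hKato : kato_charIdeal_dvd_multiplicative_of_surjective) (hJs : thm61_splitMultiplicative)
    (hJn : thm61_nonsplitMultiplicative) (hHs : exists_isSplitMultCanonical)
    (hHn : exists_isMultCanonical) (hDf : Disegni2020.thm1_padicBSD_rankOne_multiplicative)
    (hGZK : rank_eq_analyticRank_of_analyticRank_le_one) (hpar : nonempty_modularParametrizationData)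
    (hC : ∀ (W : WeierstrassCurve ℚ) [W.IsElliptic] [W.IsGloballyMinimal], ClassX11b W 3 → Surj W 3 →
      W.HasSplitMultiplicativeReductionAtPrime 3 → ClassClosure.RelativeExceptionalLeadingTermAt W 3)
    (hSchS : ∀ (W : WeierstrassCurve ℚ) [W.IsElliptic] [W.IsGloballyMinimal], ClassX11b W 3 → Surj W 3 →
      W.HasSplitMultiplicativeReductionAtPrime 3 → ∀ (Dq : TateParameterData W 3) (Dh : PAdicHeightData W 3),
        IsSplitMultCanonical Dh Dq → SchneiderConjecture Dh)
    (hSchN : ∀ (W : WeierstrassCurve ℚ) [W.IsElliptic] [W.IsGloballyMinimal], ClassX11b W 3 → ¬ Ram W 3 →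
      Surj W 3 → ¬ W.HasSplitMultiplicativeReductionAtPrime 3 →
        ∀ (q : ℚ_[3]) (Dh : PAdicHeightData W 3), q ≠ 0 → ‖q‖ < 1 → tateJ q = (W.j : ℚ_[3]) →
          IsMultCanonical Dh q → SchneiderConjecture Dh) :
    Summit.BirchSwinnertonDyer.BirchSwinnertonDyer.Theses.KolyvaginRoadThree.EulerHalvesAtThree :=
  classRecordThree_eulerHalvesAtThree_of_conjecture_of_schneider hKato hJs hJn hHs hHn hDf hGZK hpar hC
    hSchS hSchN

/-- **Bundled form**: conj@3 on the split locus of X11b@3 ∩ `Surj` + rung I1 at `3` on X11b@3 ∩ `Surj`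
(`ClassClosure.RegulatorNonvanishingAt W 3`, both Schneider halves; `Surj` is automatic on (ram)) ⟹
the crux. CONDITIONAL; nothing booked. [cite: Wuthrich2014, Thm. 3, Cor. 19]
[cite: SteinWuthrich2013, Thm. 6.1, §4.2] [cite: Disegni2020, Thm. 1 (§1.2)] -/
theorem classRecordThree_eulerHalvesAtThree_of_conjecture_of_regulatorNonvanishing
    (hKato : kato_charIdeal_dvd_multiplicative_of_surjective) (hJs : thm61_splitMultiplicative)
    (hJn : thm61_nonsplitMultiplicative) (hHs : exists_isSplitMultCanonical)
    (hHn : exists_isMultCanonical) (hDf : Disegni2020.thm1_padicBSD_rankOne_multiplicative)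
    (hGZK : rank_eq_analyticRank_of_analyticRank_le_one) (hpar : nonempty_modularParametrizationData)
    (hC : ∀ (W : WeierstrassCurve ℚ) [W.IsElliptic] [W.IsGloballyMinimal], ClassX11b W 3 → Surj W 3 →
      W.HasSplitMultiplicativeReductionAtPrime 3 → ClassClosure.RelativeExceptionalLeadingTermAt W 3)
    (hReg : ∀ (W : WeierstrassCurve ℚ) [W.IsElliptic] [W.IsGloballyMinimal], ClassX11b W 3 → Surj W 3 →
      ClassClosure.RegulatorNonvanishingAt W 3) :
    Summit.BirchSwinnertonDyer.BirchSwinnertonDyer.Theses.ClassRecordThree.EulerHalvesAtThree :=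
  classRecordThree_eulerHalvesAtThree_of_conjecture_of_schneider hKato hJs hJn hHs hHn hDf hGZK hpar hC
    (fun W _ _ hX hsurj _ ↦ (hReg W hX hsurj).2) (fun W _ _ hX _ hsurj _ ↦ (hReg W hX hsurj).1)

/-- **The `KolyvaginRoadThree` twin of the bundled form.** [cite: Wuthrich2014, Thm. 3, Cor. 19]
[cite: SteinWuthrich2013, Thm. 6.1, §4.2] [cite: Disegni2020, Thm. 1 (§1.2)] -/
theorem kolyvaginRoadThree_eulerHalvesAtThree_of_conjecture_of_regulatorNonvanishing
    (hKato : kato_charIdeal_dvd_multiplicative_of_surjective) (hJs : thm61_splitMultiplicative)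
    (hJn : thm61_nonsplitMultiplicative) (hHs : exists_isSplitMultCanonical)
    (hHn : exists_isMultCanonical) (hDf : Disegni2020.thm1_padicBSD_rankOne_multiplicative)
    (hGZK : rank_eq_analyticRank_of_analyticRank_le_one) (hpar : nonempty_modularParametrizationData)
    (hC : ∀ (W : WeierstrassCurve ℚ) [W.IsElliptic] [W.IsGloballyMinimal], ClassX11b W 3 → Surj W 3 →
      W.HasSplitMultiplicativeReductionAtPrime 3 → ClassClosure.RelativeExceptionalLeadingTermAt W 3)
    (hReg : ∀ (W : WeierstrassCurve ℚ) [W.IsElliptic] [W.IsGloballyMinimal], ClassX11b W 3 → Surj W 3 →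
      ClassClosure.RegulatorNonvanishingAt W 3) :
    Summit.BirchSwinnertonDyer.BirchSwinnertonDyer.Theses.KolyvaginRoadThree.EulerHalvesAtThree :=
  classRecordThree_eulerHalvesAtThree_of_conjecture_of_regulatorNonvanishing hKato hJs hJn hHs hHn hDf
    hGZK hpar hC hReg

/-- **`PublishedInputsThree` packaging** (item 19112, BY NAME: conjuncts 6 `hGZK`, 15 `hJn`, 16 `hHn`,
17 `hDf`, 18 `hpar`) + the THREE published facts the class record does not carry (Kato's divisibility in
Wuthrich's surjective shape, SW Thm. 6.1 SPLIT, the split canonical height of SW §4.2) + conj@3 on the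
split locus + rung I1 at `3` ⟹ the crux — the shape in which a planner may register this road as a
second supplier of crux 19109 (`EulerHalvesAtThree_of (h : PublishedInputsThree)` in the line file).
CONDITIONAL; nothing booked. [cite: Wuthrich2014, Thm. 3, Cor. 19] [cite: SteinWuthrich2013, Thm. 6.1, §4.2]
[cite: Disegni2020, Thm. 1 (§1.2)] -/
theorem classRecordThree_eulerHalvesAtThree_of_publishedInputs_of_conjecture_of_regulatorNonvanishing
    (h : Summit.BirchSwinnertonDyer.BirchSwinnertonDyer.Theses.ClassRecordThree.PublishedInputsThree)
    (hKato : kato_charIdeal_dvd_multiplicative_of_surjective) (hJs : thm61_splitMultiplicative)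
    (hHs : exists_isSplitMultCanonical)
    (hC : ∀ (W : WeierstrassCurve ℚ) [W.IsElliptic] [W.IsGloballyMinimal], ClassX11b W 3 → Surj W 3 →
      W.HasSplitMultiplicativeReductionAtPrime 3 → ClassClosure.RelativeExceptionalLeadingTermAt W 3)
    (hReg : ∀ (W : WeierstrassCurve ℚ) [W.IsElliptic] [W.IsGloballyMinimal], ClassX11b W 3 → Surj W 3 →
      ClassClosure.RegulatorNonvanishingAt W 3) :
    Summit.BirchSwinnertonDyer.BirchSwinnertonDyer.Theses.ClassRecordThree.EulerHalvesAtThree := by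
  obtain ⟨-, -, -, -, -, hGZK, -, -, -, -, -, -, -, -, hJn, hHn, hDf, hpar, -, -⟩ := h
  exact classRecordThree_eulerHalvesAtThree_of_conjecture_of_regulatorNonvanishing hKato hJs hJn hHs hHn
    hDf hGZK hpar hC hReg

end Crux

end Summit.BirchSwinnertonDyer.BirchSwinnertonDyer.Theorems.ExceptionalZeroRoad

end
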